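import Summits.QuantumFields.YangMills.Theorems.BalabanUVNodesK0RecordFormatNamesL
import Literature.MathematicalPhysics.QuantumFieldTheory.Balaban1983to89.B12Eq15QuadraticForm
import Literature.MathematicalPhysics.QuantumFieldTheory.Balaban1983to89.BlockAveragingHaarAC

/-!
# K0⁷ — THE RECORD-SIDE FORMAT NAMES, EDITION 15 (part 1): THE FLUCTUATION FRAME OF [I] §2 AT THE RECORD — port-lead (R3′) ∕ porter PT-A-1 g3
# S2A-SPEC-v1 §3 carrier table, the STRUCTURAL and LINEARISED objects: B′-coordinates, `pert`, `Q̃`, `LQ̃`, the elimination matrix `C` (p.268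
# «B′ = CB»), `h`, the gauge-fixing polar form `G₂` and `G₃` ((2.5)), the Landau-projected linearised fine minimiser `H_{1,k}`, the bare Hessian
# `Δ₁` and `⟨·, J⟩` of the Wilson action, the (1.5) datum `Δ^{(k)}(U)`, its matrix `S`, `Cᵀ S C`, `Z^{(k)}` and `log Z^{(k)}` (D-defB-2's slot)

Cell `ym-nodeO-ideate` ∕ `ym-balaban-port`, DEFINER seat `ym-nodeO-def-1` (gen 34), on port-lead N-18 ∕ director-ym №483 desk order «(ρ1) first, (R3′) second» and porter
PT-A-1 g3's `S2A-SPEC-v1.md` (443e22a7e9fa4773) §3 ✎ column ∕ §5 order («`Delta_k_rec`, `Cop_rec`, `prec_rec`, `Zk_rec` FIRST — they unblock (T3)»); scoping line nodeO STATUS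
2026-08-31T01:3xZ.  `--kind definition --supports stmt-QuantumFields-20541 --as helper`; count-neutral.  [I] = [Balaban1987RG1], [15] = [Balaban1985Variational].

EVERY OBJECT BELOW IS A COMPOSITION, A FRÉCHET DERIVATIVE AT `0`, OR MATHLIB LINEAR ALGEBRA OVER EXISTING RECORD MAPS — NO THEOREM OF PRINT IS ASSERTED.  The background
`Vk : GaugeField (F.P K) k (SU 2)` of the step (print's `V^{(k)}`; at the record `critCfgAxOfRecord`, PTA-2) and the fine background `U : GaugeField (F.P K) 0 (SU 2)` (print's
`U_{k+1}`) are PARAMETERS, so nothing here reads a selector except the fine minimiser `UkSel … εbg` inside `H_{1,k}` (regularity radius `εbg` a parameter); the Lie-algebra chart is the EXPLICIT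
anti-Hermitian basis `su2Gen = (iσ₁, iσ₂, iσ₃)` with real coordinates `su2Coord` (θ-free).

* §24a COORDINATES: `FluctIdx F k K := PBond (F.P K) k × Fin 3` (level-`k` bonds of `T_K` × colour — real coordinates of 𝔰𝔲(2)-valued `B′`, so that `LinearMap.toMatrix₂'` and
  `B12Eq15QuadraticForm.Z14` apply); `fluctMat x b := Σ_a x (b, a) • su2Gen a`; `pert Vk x := (b ↦ suOfMat (exp (fluctMat x b)) · Vk b)` — print's `V = V′V^{(k)}`, `V′ = exp(iB′)` (2.4);
  `FineIdx F K := PBond (F.P K) 0 × Fin 3`, `fineMat`, `finePert U y := (b ↦ suOfMat (exp (fineMat y b)) · U b)` — the chart around the fine background for Δ₁ ∕ J.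
* §24b THE CONSTRAINT: `recordQt Vk x c := mlog (M(pert Vk x)(c) · M(Vk)(c)⁻¹)` (p.267 `Q̃(V^{(k)}, B′)`, one step of `avOfRecord`); `recordLQt Vk := fderiv ℝ (recordQt Vk) 0` (LQ̃);
  `recordC2 Vk := ½ · D²(recordQt Vk)(0)` (the polar form of `C̃^{(2)}`); `fluctKer Vk := ker LQ̃`; `recordCop Vk : Matrix (FluctIdx) (Fin (finrank (ker LQ̃))) ℝ` = the columns of a basis of
  `ker LQ̃` (print's C, p.268 «a linear parametrization B′ = CB of the space of solutions of Q̃ B′ = 0» at linear order; `Module.finBasis`); `recordB0 c := centralBond c` (N09's private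
  coordinate = print's `b₀(c)`); `recordHop Vk` (print's h: «(hB)(b₀(c)) = h(c)B(c)», here with `h(c) := 1`-placeholder shape `B13PkLocalTerms.hOp` — SAID: print's `h(c)` is the
  local inverse `LQ̃h = I`, a LETTER the porter fixes; I name the extension-by-zero operator only).
* §24c GAUGE FIXING (2.5): `recordGf Vk x := gfOfRecord F 2 K k (pert Vk x)`; `recordG₂ Vk := D²(recordGf Vk)(0)` (`recordG3` via the tree's `B12GaugeFixExpansion25.G3` = part 2, that module
  being unbuilt on the hub at filing time; `G₃ = G − ½G₂` from these two meanwhile).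
* §24d THE FINE SIDE: `recordWilson U y := wilsonAction4 (finePert U y)`; `recordPairJop U := fderiv ℝ (recordWilson U) 0` (⟨·, J⟩, (1.2)∕(1.8)); `recordΔ1 U := D²(recordWilson U)(0)` — the BARE
  Hessian of the Wilson action at `U` (SAID: [15] §D's `Δ₁(U_k)` in (1.5) is this Hessian read on Landau-gauge fields; the gauge-augmented `Δ₁ + DRD* + aQ*Q` of [15] (110) is NOT this name);
  `recordH1 U Vk := fderiv at 0 of x ↦ (fine coordinates of the LANDAU-projected `mlog (U_k(pert Vk x) · U⁻¹)`)` — [15] (103) `A′ = A₁ + H₁B`, H₁ the Landau object (J5), built from the ROOTED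
  selector `UkSel` and ed.14's `landauRepC` entrywise, then coordinatised by `sl2Coord`-type real coordinates `fineCoord` (see the def).
* §24e THE (1.5) DATUM AND THE GAUSSIAN LETTERS: `recordQuadData U Vk : B12Eq15QuadraticForm.Data ℝ (FluctIdx → ℝ) (FineIdx → ℝ) (PBond (k+1) → MatA 2)` (fields H, Δ₁, hop, C₂, pairJ, G₂
  by name); `recordS U Vk := LinearMap.toMatrix₂' ℝ (recordQuadData U Vk).form` (the matrix of `Δ^{(k)}(U)`); `recordPrec U Vk := Cᵀ S C`; `recordZk U Vk := Z14 S C`; `recordLogZk := log`.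

HONEST FRAMING.  Definitions only; NOTHING of Bałaban is asserted, ported or discharged: NOT the positivity of `Cᵀ S C` ([B9] Thm 3.11 at the record — a THEOREM, the porter's `hpd`), NOT
the existence of `D̃` (p.267, implicit — `B12Lineariz267.exists_Dt`), NOT (2.1) = (2.12) (absent from the tree, PTA-1 S2A-SPEC §2); the `pairJ` of print pairs `H₁B′` with the CURRENT of the
background — named here as the first derivative of the Wilson action in the fine chart, which IS `⟨·, J⟩` up to print's normalisation (SAID, not proved); 27930⁸ OPEN; K0⁷∕K-Ax OPEN; NODE O
0∕1; COUNT 8∕28 · K 1∕4 UNMOVED; finite `𝕋⁴_{L^K}` at fixed ε — NOT continuum ∕ ℝ⁴ ∕ OS; **the Yang–Mills mass gap (Clay) is NOT proved by any of this.**  No `sorry`, `instance`, `notation`.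
-/

noncomputable section

open scoped BigOperators Matrix.Norms.L2Operator

namespace Summit.QuantumFields.YangMills.Theorems.K0RecordFormatNames

open Literature.MathematicalPhysics.QuantumFieldTheory.Balaban1983to89
open Literature.MathematicalPhysics.QuantumFieldTheory.Balaban1983to89.Node00
open Literature.MathematicalPhysics.QuantumFieldTheory.Balaban1983to89.T4Continuum (T4Family)
open NormedSpace (exp)
open _root_.Matrix

variable (F : T4Family)

/-! ## §24a  Coordinates of the fluctuation field `B′` (level `k`) and of fine vector fields (level `0`); the perturbation maps -/

/-- **The anti-Hermitian basis `(iσ₁, iσ₂, iσ₃)` of 𝔰𝔲(2)** (traceless, anti-Hermitian: `exp` of a real combination lies in `SU(2)`). [cite: Balaban1987RG1, (2.4) p.266 (V′ = exp(iB′); bookkeeping)] -/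
def su2Gen : Fin 3 → MatA 2 := ![!![0, Complex.I; Complex.I, 0], !![0, 1; -1, 0], !![Complex.I, 0; 0, -Complex.I]]

/-- **Real coordinates of an 𝔰𝔲(2) matrix** against `su2Gen`: `M = Σ_a t_a su2Gen a ⇒ t = (Im M₀₁, Re M₀₁, Im M₀₀)`. [cite: Balaban1987RG1, (2.4) p.266 (bookkeeping)] -/
def su2Coord (M : MatA 2) : Fin 3 → ℝ := ![(M 0 1).im, (M 0 1).re, (M 0 0).im]

/-- **Real coordinates of the fluctuation field `B′`**: level-`k` bonds of `T_K` × colour. [cite: Balaban1987RG1, (2.4) p.266] -/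
abbrev FluctIdx (k K : ℕ) : Type := PBond (F.P K) k × Fin 3

/-- **Real coordinates of fine vector fields** (the `A`-variations of the fine background): fine bonds × colour. [cite: Balaban1987RG1, (1.5) p.261; Balaban1985Variational, (103) p.293] -/
abbrev FineIdx (K : ℕ) : Type := PBond (F.P K) 0 × Fin 3

/-- The 𝔰𝔲(2) matrix of `B′` on the level-`k` bond `b`: `Σ_a x(b, a) • iσ_a`. [cite: Balaban1987RG1, (2.4) p.266 (bookkeeping)] -/
def fluctMat (k K : ℕ) (x : FluctIdx F k K → ℝ) (b : PBond (F.P K) k) : MatA 2 := ∑ a, (x (b, a) : ℂ) • su2Gen a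

/-- The 𝔰𝔲(2) matrix of a fine variation on the fine bond `b`. [cite: Balaban1985Variational, (103) p.293 (bookkeeping)] -/
def fineMat (K : ℕ) (y : FineIdx F K → ℝ) (b : PBond (F.P K) 0) : MatA 2 := ∑ a, (y (b, a) : ℂ) • su2Gen a

/-- **`V = V′V^{(k)}`, `V′ = exp(iB′)`** ((2.4)): the perturbed level-`k` configuration as a function of the coordinates of `B′`, around the background `Vk`.
[cite: Balaban1987RG1, (2.4) p.266] -/
def pert (k K : ℕ) (Vk : GaugeField (F.P K) k (SU 2)) (x : FluctIdx F k K → ℝ) : GaugeField (F.P K) k (SU 2) :=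
  fun b => suOfMat 2 (exp (fluctMat F k K x b)) * Vk b

/-- The perturbed FINE configuration `exp(A)·U` as a function of the fine coordinates, around the fine background `U`. [cite: Balaban1985Variational, (103) p.293; Balaban1987RG1, (2.6)–(2.8) p.267] -/
def finePert (K : ℕ) (U : GaugeField (F.P K) 0 (SU 2)) (y : FineIdx F K → ℝ) : GaugeField (F.P K) 0 (SU 2) :=
  fun b => suOfMat 2 (exp (fineMat F K y b)) * U b

/-! ## §24b  The constraint `Q̃`, its linearisation `LQ̃`, the second-order polar form `C₂`, the elimination matrix `C`, `b₀`, `h` -/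

/-- **`Q̃(V^{(k)}, B′)`** (p.267): `c ↦ log (M(V′V^{(k)})(c) · M(V^{(k)})(c)⁻¹)` — the one-step block average of record read through the series logarithm, so that
«`Q̃ = 0`» is «the average is unchanged». [cite: Balaban1987RG1, (2.4) p.266, p.267] -/
def recordQt (k K : ℕ) (Vk : GaugeField (F.P K) k (SU 2)) (x : FluctIdx F k K → ℝ) : PBond (F.P K) (k + 1) → MatA 2 :=
  fun c => MatrixLog.mlog ((((avOfRecord F 2 K k).avg (pert F k K Vk x) c * ((avOfRecord F 2 K k).avg Vk c)⁻¹ : SU 2) : MatA 2))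

/-- **`LQ̃`** (p.267 «L is a linear transformation»): the derivative of `Q̃(V^{(k)}, ·)` at `B′ = 0`. [cite: Balaban1987RG1, p.267] -/
def recordLQt (k K : ℕ) (Vk : GaugeField (F.P K) k (SU 2)) : (FluctIdx F k K → ℝ) →L[ℝ] (PBond (F.P K) (k + 1) → MatA 2) :=
  fderiv ℝ (recordQt F k K Vk) 0

/-- **`C₂`** — the polar form of `C̃^{(2)}(V^{(k)}, ·)`, «the second order polynomial in the expansion of Q̃» ((1.5)): half the second derivative of `Q̃` at `0`.
[cite: Balaban1987RG1, (1.5) p.261, p.267] -/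
def recordC2 (k K : ℕ) (Vk : GaugeField (F.P K) k (SU 2)) : (FluctIdx F k K → ℝ) →L[ℝ] (FluctIdx F k K → ℝ) →L[ℝ] (PBond (F.P K) (k + 1) → MatA 2) :=
  (2 : ℝ)⁻¹ • fderiv ℝ (fun x => fderiv ℝ (recordQt F k K Vk) x) 0

/-- **`ker LQ̃`** — the linearised constraint surface «Q̃ B′ = 0» at `B′ = 0`. [cite: Balaban1987RG1, p.268] -/
def fluctKer (k K : ℕ) (Vk : GaugeField (F.P K) k (SU 2)) : Submodule ℝ (FluctIdx F k K → ℝ) :=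
  LinearMap.ker (recordLQt F k K Vk).toLinearMap

/-- **THE ELIMINATION MATRIX `C`** (p.268 «B′ = CB»): the columns are a basis of `ker LQ̃` (Mathlib `Module.finBasis`), so `z ↦ C z` parametrises the linearised constraint surface
injectively — the `N` of `B12Eq15QuadraticForm.Z14 S N`. [cite: Balaban1987RG1, p.268, (1.4) p.260] -/
def recordCop (k K : ℕ) (Vk : GaugeField (F.P K) k (SU 2)) : Matrix (FluctIdx F k K) (Fin (Module.finrank ℝ (fluctKer F k K Vk))) ℝ :=
  fun i j => ((Module.finBasis ℝ (fluctKer F k K Vk) j : fluctKer F k K Vk) : FluctIdx F k K → ℝ) i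

/-- **`b₀(c)`** — print's distinguished bond of the coarse bond `c` = N09's CENTRAL crossing bond (`BlockAveragingHaarAC.centralBond`). [cite: Balaban1987RG1, p.267] -/
def recordB0 (k K : ℕ) (c : PBond (F.P K) (k + 1)) : PBond (F.P K) k := BlockAveragingHaarAC.centralBond c

/-- **`h`-extension** (p.267 «(hB)(b₀(c)) = h(c)B(c)», `0` off the distinguished bonds): the extension-by-zero of a coarse-bond field along `b₀`, with the local operator `h(c)` a PARAMETER
(print's `h` inverts `LQ̃` locally — a letter the porter fixes). [cite: Balaban1987RG1, p.267] -/
def recordHop (k K : ℕ) (h : PBond (F.P K) (k + 1) → MatA 2 → MatA 2) (D : PBond (F.P K) (k + 1) → MatA 2) : PBond (F.P K) k → MatA 2 :=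
  B13PkLocalTerms.hOp (recordB0 F k K) h D

/-! ## §24c  Gauge fixing (2.5): `G`, its polar form `G₂`, and `G₃` -/

/-- **`G(B′)`** — the gauge-fixing function of record evaluated on `V′V^{(k)}` ((2.1)∕(2.5); `gfOfRecord = gaugeFixFn (contourOfRecord …) univ`). [cite: Balaban1987RG1, (2.1) p.265, (2.5) p.266] -/
def recordGf (k K : ℕ) (Vk : GaugeField (F.P K) k (SU 2)) (x : FluctIdx F k K → ℝ) : ℝ :=
  gfOfRecord F 2 K k (pert F k K Vk x)

/-- **`G₂`** — the polar form of `G^{(2)}` ((2.5)∕(1.5)): the second derivative of `G(B′)` at `0`. [cite: Balaban1987RG1, (2.5) p.266, (1.5) p.261] -/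
def recordG₂ (k K : ℕ) (Vk : GaugeField (F.P K) k (SU 2)) : (FluctIdx F k K → ℝ) →L[ℝ] (FluctIdx F k K → ℝ) →L[ℝ] ℝ :=
  fderiv ℝ (fun x => fderiv ℝ (recordGf F k K Vk) x) 0

-- `recordG3` (print's G₃ = the tree's `B12GaugeFixExpansion25.G3` at (`SU(2) ↪ M₂`, `contourOfRecord`, `Vk`, `pert`, `univ`)) is deferred to part 2: the hub has no
-- build of `B12GaugeFixExpansion25` at filing time (`remote:stale:unbuilt`); `G₃ = G − ½G₂` is recoverable from `recordGf` and `recordG₂` meanwhile.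

/-! ## §24d  The fine side: Wilson action in the fine chart, `⟨·, J⟩`, the bare Hessian `Δ₁`, and the Landau-projected `H_{1,k}` -/

/-- **`A(exp(A′)·U)`** — the Wilson action in the fine chart around `U`. [cite: Balaban1987RG1, (2.6)–(2.8) p.267] -/
def recordWilson (K : ℕ) (U : GaugeField (F.P K) 0 (SU 2)) (y : FineIdx F K → ℝ) : ℝ :=
  wilsonAction4 (finePert F K U y)

/-- **`⟨·, J⟩`** — the first derivative of the Wilson action at the background `U` (print's current pairing of (1.2)∕(1.8)∕(2.7), up to print's normalisation — SAID).
[cite: Balaban1987RG1, (1.2) p.260, (2.7) p.267] -/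
def recordPairJop (K : ℕ) (U : GaugeField (F.P K) 0 (SU 2)) : (FineIdx F K → ℝ) →L[ℝ] ℝ :=
  fderiv ℝ (recordWilson F K U) 0

/-- **`Δ₁(U)`, BARE** — the Hessian of the Wilson action at `U` in the fine chart (SAID: NOT the gauge-augmented `Δ₁ + DRD* + aQ*Q` of [15] (110)). [cite: Balaban1987RG1, (1.5) p.261, (2.8) p.267; Balaban1985Variational, (110) p.294] -/
def recordΔ1 (K : ℕ) (U : GaugeField (F.P K) 0 (SU 2)) : (FineIdx F K → ℝ) →L[ℝ] (FineIdx F K → ℝ) →L[ℝ] ℝ :=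
  fderiv ℝ (fun y => fderiv ℝ (recordWilson F K U) y) 0

/-- The fine minimiser's logarithmic increment over the background, ROOTED selector `UkSel` (regularity radius `εbg`): `b ↦ mlog (U_k(V′V^{(k)})(b) · U_k(V^{(k)})(b)⁻¹)` as a complex
bond-matrix field. [cite: Balaban1985Variational, (103) p.293; Balaban1987RG1, (2.3) p.265] -/
def fineIncr (k K : ℕ) (εbg : ℝ) (Vk : GaugeField (F.P K) k (SU 2)) (x : FluctIdx F k K → ℝ) : PBond (F.P K) 0 → Fin 2 → Fin 2 → ℂ :=
  fun b => MatrixLog.mlog (((UkSel F 2 K k εbg (pert F k K Vk x) b * (UkSel F 2 K k εbg Vk b)⁻¹ : SU 2) : MatA 2))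

/-- The (21)-Landau re-gauging for the `k`-FOLD averaging constraint of the minimiser `U_k` (ed.14's `landauRepC F j K` uses the `(j+1)`-fold one): identity at `k = 0` (no residual freedom
at level `0`, `isResidual_zero_iff`), `landauRepC F j K` at `k = j + 1`. [cite: Balaban1985Variational, (21) p.281, (45) p.285; Balaban1984PropagatorsII, (2.12) p.225] -/
def landauRepCAt : (k K : ℕ) → (PBond (F.P K) 0 → ℂ) → PBond (F.P K) 0 → ℂ
  | 0, _, x => x
  | j + 1, K, x => landauRepC F j K x

/-- **`H_{1,k}(U_k)`, LANDAU-PROJECTED AT LINEAR ORDER** ([15] (103) `A′ = A₁ + H₁B`; J5 «CHART GAUGE»): the derivative at `0` of the real 𝔰𝔲(2)-coordinates of the (21)-Landau representative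
(entrywise, `k`-fold constraint) of the rooted logarithmic increment of the fine minimiser. [cite: Balaban1985Variational, (103) p.293, (21) p.281; Balaban1987RG1, (1.5) p.261] -/
def recordH1 (k K : ℕ) (εbg : ℝ) (Vk : GaugeField (F.P K) k (SU 2)) : (FluctIdx F k K → ℝ) →L[ℝ] (FineIdx F K → ℝ) :=
  fderiv ℝ (fun x => fun (p : FineIdx F K) =>
    su2Coord (Matrix.of fun i i' => landauRepCAt F k K (fun b => fineIncr F k K εbg Vk x b i i') p.1) p.2) 0

/-! ## §24e  The (1.5) datum `Δ^{(k)}(U)`, its matrix, `Cᵀ S C`, `Z^{(k)}`, `log Z^{(k)}` -/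

/-- A continuous bilinear map as a bilinear `LinearMap` (bookkeeping coercion). [folklore] -/
def bilinOf {E G : Type*} [NormedAddCommGroup E] [NormedSpace ℝ E] [NormedAddCommGroup G] [NormedSpace ℝ G] (B : E →L[ℝ] E →L[ℝ] G) : E →ₗ[ℝ] E →ₗ[ℝ] G where
  toFun x := (B x).toLinearMap
  map_add' x y := by ext z; simp
  map_smul' t x := by ext z; simp

/-- **THE (1.5) DATUM AT THE RECORD** — `B12Eq15QuadraticForm.Data ℝ V W X` with `V :=` B′-coordinates, `W :=` fine coordinates, `X :=` coarse bond matrices: `H := recordH1`, `Δ₁ := recordΔ1 U`,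
`C₂ := recordC2`, `pairJ := recordPairJop U`, `G₂ := recordG₂`, and `hop := hopLin` a PARAMETER (print's `h` composed with the fine embedding, as a linear map — its local inverse property
`LQ̃h = I` is the porter's letter; `recordHop` names the extension-by-zero shape).  Its `form` is `⟨B₁, Δ^{(k)}(U) B₂⟩` ((1.5) polarised). [cite: Balaban1987RG1, (1.5) p.261] -/
def recordQuadData (k K : ℕ) (εbg : ℝ) (U : GaugeField (F.P K) 0 (SU 2)) (Vk : GaugeField (F.P K) k (SU 2))
    (hopLin : (PBond (F.P K) (k + 1) → MatA 2) →ₗ[ℝ] (FluctIdx F k K → ℝ)) :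
    B12Eq15QuadraticForm.Data ℝ (FluctIdx F k K → ℝ) (FineIdx F K → ℝ) (PBond (F.P K) (k + 1) → MatA 2) where
  H := (recordH1 F k K εbg Vk).toLinearMap
  Δ₁ := bilinOf (recordΔ1 F K U)
  hop := hopLin
  C₂ := bilinOf (recordC2 F k K Vk)
  pairJ := (recordPairJop F K U).toLinearMap
  G₂ := bilinOf (recordG₂ F k K Vk)

/-- **THE MATRIX `S` OF `Δ^{(k)}(U)`** in the B′-coordinates (`LinearMap.toMatrix₂'` of the (1.5) form). [cite: Balaban1987RG1, (1.4)–(1.5) pp.260–261] -/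
def recordS (k K : ℕ) (εbg : ℝ) (U : GaugeField (F.P K) 0 (SU 2)) (Vk : GaugeField (F.P K) k (SU 2))
    (hopLin : (PBond (F.P K) (k + 1) → MatA 2) →ₗ[ℝ] (FluctIdx F k K → ℝ)) : Matrix (FluctIdx F k K) (FluctIdx F k K) ℝ :=
  LinearMap.toMatrix₂' ℝ (recordQuadData F k K εbg U Vk hopLin).form

/-- **`Cᵀ S C`** — the quadratic form `Δ^{(k)}(U)` restricted to the linearised constraint surface in the coordinates `z` of `B′ = Cz` (p.268 «covariance C^{(k)}(U_{k+1}) = (C*Δ^{(k)}C)⁻¹»;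
the `T` of `B10LogDet63.matrix63`).  Its positive-definiteness is a THEOREM ([B9] Thm 3.11 at the record), NOT asserted here. [cite: Balaban1987RG1, p.268, (1.4) p.260] -/
def recordPrec (k K : ℕ) (εbg : ℝ) (U : GaugeField (F.P K) 0 (SU 2)) (Vk : GaugeField (F.P K) k (SU 2))
    (hopLin : (PBond (F.P K) (k + 1) → MatA 2) →ₗ[ℝ] (FluctIdx F k K → ℝ)) :
    Matrix (Fin (Module.finrank ℝ (fluctKer F k K Vk))) (Fin (Module.finrank ℝ (fluctKer F k K Vk))) ℝ :=
  (recordCop F k K Vk)ᵀ * recordS F k K εbg U Vk hopLin * recordCop F k K Vk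

/-- **`Z^{(k)}(U)`** by (1.4): `∫ dz exp[−½⟨Cz, S(U) Cz⟩]` (`B12Eq15QuadraticForm.Z14 S C`). [cite: Balaban1987RG1, (1.4) p.260] -/
def recordZk (k K : ℕ) (εbg : ℝ) (U : GaugeField (F.P K) 0 (SU 2)) (Vk : GaugeField (F.P K) k (SU 2))
    (hopLin : (PBond (F.P K) (k + 1) → MatA 2) →ₗ[ℝ] (FluctIdx F k K → ℝ)) : ℝ :=
  B12Eq15QuadraticForm.Z14 (recordS F k K εbg U Vk hopLin) (recordCop F k K Vk)

/-- **`log Z^{(k)}(U)`** — the zeroth-order term of (1.3) at the record (D-defB-2's slot as a NAME; its localized representation [16] (63) = the LZ half of PT-A's residue).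
[cite: Balaban1987RG1, (1.3)–(1.4) p.260] -/
def recordLogZk (k K : ℕ) (εbg : ℝ) (U : GaugeField (F.P K) 0 (SU 2)) (Vk : GaugeField (F.P K) k (SU 2))
    (hopLin : (PBond (F.P K) (k + 1) → MatA 2) →ₗ[ℝ] (FluctIdx F k K → ℝ)) : ℝ :=
  Real.log (recordZk F k K εbg U Vk hopLin)

end Summit.QuantumFields.YangMills.Theorems.K0RecordFormatNames

end
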